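import Summits.ValiantsHypothesis.ValiantsHypothesis.Theorems.FifoMatchingNNDivisionHardLocalizationCubeSpecies
import Summits.ValiantsHypothesis.ValiantsHypothesis.Theorems.FifoMatchingNNDivisionHardSparseEdgePassenger

/-!
# FAT TWINS — the kernel form of sieve lemma L1 of `NonZonotope44.md` (val-idea-44 g1, W7 lane (b), crux stmt-ValiantsHypothesis-21181)

A COMPOSITION of two Theorems-level engines of the cell, in val-idea-43's localization framework
(`…Theorems.FifoMatching.Localization`: `PClass`, `Decided`, `Face`, `decided_face`, `face_of_twoScale`, `pinOff`, `Outside`,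
`exists_generic_outside`; part 10 `OmegaInjTop` = «Ω-injective pin-top layers are decided») with the sparse-difference passenger law
(`…Theorems.FifoMatching.SparseEdgePassenger.sparseEdgePassengerLaw_holds`, class B of the line, pen val-idea-42 / port val-port-1):

* `SparseLL` — the class of families all of whose pairwise differences touch `≤ log₂ log₂ h` indices; DECIDED (`sparseLL_decided`, a
  re-reading of `sparseEdgePassengerLaw_holds` as a `Decided` class).
* ★ `SparseTwinTop` — for SOME admissible `ι : Fin ℓ ↪ Fin h` (`⌊√h⌋ ≤ ℓ`), any two members of the `pinOff ι`-top layer that AGREE OUTSIDE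
  `ι × ι` («Ω-twins») differ on an index set of size `≤ log₂ log₂ ℓ`.  Contains `OmegaInjTop` (`omegaInjTop_le_sparseTwinTop`: equal twins
  differ on nothing).  ★★ `sparseTwinTop_decided : Decided SparseTwinTop` — via `face_of_twoScale` with second scale a generic tilt outside
  `ι × ι` (exactly as in 43's `faceQuiet_of_topLayer_injOn`): the lexicographic top sub-family consists of pairwise Ω-twins, so read on `ι` it
  lies in `SparseLL` at scale `ℓ` (`card_idxSupp_delRead_le`), and `Face SparseLL` is decided (`decided_face sparseLL_decided`).
* ★★ `enemy_fatTwins` — THE SIEVE (enemy side, clause (E-7) of `NonZonotope44.md` in kernel currency): below the budget `r ≤ T c h`, for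
  EVERY admissible `ι` the pin-top layer contains two Ω-twins whose difference (supported inside `ι × ι` on the layer) touches MORE THAN
  `log₂ log₂ ℓ` indices.
* ★★ `enemy_many_members` (§2) — THE VERTEX-COUNT FLOOR in kernel: double counting the `ι` a given fat pair can serve
  (`choose_le_of_fatTwins`: `C(h,ℓ) ≤ N²·C(h−s,ℓ−s)`; `Nat.choose_mul`) gives `C(h,s) ≤ N²·C(ℓ,s)` for every `⌊√h⌋ ≤ ℓ ≤ h`,
  `s = ⌊log₂log₂ℓ⌋ + 1`, `N = K + 1` — i.e. `N ≥ (h/ℓ)^{s/2}`, `N ≥ h^{(log₂log₂h)/4 − o(1)}` at `ℓ = ⌊√h⌋` (`enemy_many_members_sqrt`).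

The threshold `log₂ log₂` is the one of the imported class-B theorem; the window reader `cor_add_sparseDiff_decided_window` (38) would give
`ℓ / K(c,ℓ)` in the same composition once it is phrased as a `Decided` class in this currency (not done here).
HONEST FRAMING: a sieve statement about hypothetical enemies of COR-VIRTUAL; nothing closes; stmt-21181 OPEN; C′ OPEN; VP ≠ VNP NOT proved.
-/

set_option linter.unusedVariables false
set_option linter.unusedSectionVars false
set_option linter.dupNamespace false
set_option autoImplicit false

noncomputable section

namespace Summit.ValiantsHypothesis.ValiantsHypothesis.Cruxes.NNDivisionHard.FatTwins44

open Matrix Finset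
open scoped Pointwise
open Literature.Barriers.PneNP (HasEFOfSize)
open Literature.Combinatorics.Optimization (corPolytopeGraph corVec)
open Summit.ValiantsHypothesis.ValiantsHypothesis.Theorems.FifoMatching.Localization

/-- the INDEX SUPPORT of a difference: indices occurring as the row or the column of a nonzero entry (the spelling of
`sparseEdgePassengerLaw_holds`). -/
def idxSupp {h : ℕ} (d : Fin h × Fin h → ℝ) : Finset (Fin h) :=
  Finset.univ.filter fun z => ∃ z', d (z, z') ≠ 0 ∨ d (z', z) ≠ 0

/-- the class of LL-SPARSE families: every pairwise difference touches `≤ log₂ log₂ h` indices. -/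
def SparseLL : PClass := fun h K q => ∀ j j', (idxSupp (q j - q j')).card ≤ Nat.log 2 (Nat.log 2 h)

/-- ★ `SparseLL` is DECIDED — the sparse-difference passenger law (class B) read as a class theorem. -/
theorem sparseLL_decided : Decided SparseLL := by
  intro c
  obtain ⟨h₀, hh₀⟩ := Theorems.FifoMatching.SparseEdgePassenger.sparseEdgePassengerLaw_holds c
  exact ⟨h₀, fun h hh K q r hX hEF => hh₀ h hh K q r hX hEF⟩

/-- reading on `ι` does not increase the index support. -/
theorem card_idxSupp_delRead_le {h ℓ : ℕ} (ι : Fin ℓ ↪ Fin h) (d : Fin h × Fin h → ℝ) :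
    (idxSupp (delRead ι d)).card ≤ (idxSupp d).card := by
  classical
  refine Finset.card_le_card_of_injOn ι (fun z hz => ?_) (ι.injective.injOn)
  have hz' := (Finset.mem_filter.mp (Finset.mem_coe.mp hz)).2
  obtain ⟨z', hz'⟩ := hz'
  refine Finset.mem_coe.mpr (Finset.mem_filter.mpr ⟨Finset.mem_univ _, ι z', ?_⟩)
  rw [delRead_apply, delRead_apply] at hz'
  exact hz'

/-- ★ the class SPARSE-TWIN-TOP: for some admissible `ι`, Ω-twins of the `pinOff ι`-top layer differ on `≤ log₂ log₂ ℓ` indices. -/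
def SparseTwinTop : PClass := fun h K q =>
  ∃ ℓ : ℕ, Nat.sqrt h ≤ ℓ ∧ ∃ ι : Fin ℓ ↪ Fin h, ∀ j j', (∀ k, pinOff ι ⬝ᵥ q k ≤ pinOff ι ⬝ᵥ q j) →
    (∀ k, pinOff ι ⬝ᵥ q k ≤ pinOff ι ⬝ᵥ q j') → (∀ p, Outside ι p → q j p = q j' p) →
    (idxSupp (q j - q j')).card ≤ Nat.log 2 (Nat.log 2 ℓ)

/-- `OmegaInjTop ≤ SparseTwinTop`. -/
theorem omegaInjTop_le_sparseTwinTop {h K : ℕ} (q : Fam h K) (hq : OmegaInjTop h K q) : SparseTwinTop h K q := by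
  obtain ⟨ℓ, hℓ, ι, hinj⟩ := hq
  refine ⟨ℓ, hℓ, ι, fun j j' h1 h2 h3 => ?_⟩
  have h0 : q j - q j' = 0 := sub_eq_zero.mpr (hinj j j' h1 h2 h3)
  have : idxSupp (q j - q j') = ∅ := by
    rw [h0]
    unfold idxSupp
    refine Finset.filter_false_of_mem fun z _ => ?_
    push Not
    exact fun z' => ⟨rfl, rfl⟩
  rw [this, Finset.card_empty]
  exact Nat.zero_le _

/-- ★★ `SparseTwinTop ≤ Face SparseLL`: the two-scale face `(pinOff ι, generic tilt outside ι × ι)` has a top sub-family of pairwise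
Ω-twins, which read on `ι` is LL-sparse at scale `ℓ`. -/
theorem face_sparseLL_of_sparseTwinTop {h K : ℕ} (q : Fam h K) (hq : SparseTwinTop h K q) : Face SparseLL h K q := by
  classical
  obtain ⟨ℓ, hℓ, ι, hsp⟩ := hq
  -- a generic tilt separating the Ω-distinct pairs (as in `faceQuiet_of_topLayer_injOn`)
  let G : Fin (K + 1) × Fin (K + 1) → (Fin h × Fin h → ℝ) := fun jj => q jj.1 - q jj.2
  obtain ⟨v, hv0, hvG⟩ := exists_generic_outside ι
    (Finset.univ.filter fun jj : Fin (K + 1) × Fin (K + 1) => ∃ p, Outside ι p ∧ G jj p ≠ 0) G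
    (fun jj hjj => (Finset.mem_filter.mp hjj).2)
  have hv : ∀ b : Fin h → Bool, pinOff ι ⬝ᵥ corVec (⊤ : SimpleGraph (Fin h)) b = 0 →
      v ⬝ᵥ corVec (⊤ : SimpleGraph (Fin h)) b = 0 := pinOff_outside ι v hv0
  -- the lexicographic top set is nonempty
  obtain ⟨j₁, -, hj₁⟩ := Finset.exists_max_image Finset.univ (fun j => pinOff ι ⬝ᵥ q j) Finset.univ_nonempty
  let Tl : Finset (Fin (K + 1)) := Finset.univ.filter fun j => ∀ k, pinOff ι ⬝ᵥ q k ≤ pinOff ι ⬝ᵥ q j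
  have hTl : Tl.Nonempty := ⟨j₁, Finset.mem_filter.mpr ⟨Finset.mem_univ _, fun k => hj₁ k (Finset.mem_univ k)⟩⟩
  obtain ⟨j₀, hj₀T, hj₀⟩ := Finset.exists_max_image Tl (fun j => v ⬝ᵥ q j) hTl
  have hj₀top : ∀ k, pinOff ι ⬝ᵥ q k ≤ pinOff ι ⬝ᵥ q j₀ := (Finset.mem_filter.mp hj₀T).2
  let LT : Finset (Fin (K + 1)) := Finset.univ.filter fun j =>
    ∀ k, pinOff ι ⬝ᵥ q k < pinOff ι ⬝ᵥ q j ∨ (pinOff ι ⬝ᵥ q k = pinOff ι ⬝ᵥ q j ∧ v ⬝ᵥ q k ≤ v ⬝ᵥ q j)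
  have hj₀LT : j₀ ∈ LT := by
    refine Finset.mem_filter.mpr ⟨Finset.mem_univ _, fun k => ?_⟩
    rcases (hj₀top k).lt_or_eq with hlt | heq
    · exact Or.inl hlt
    · exact Or.inr ⟨heq, hj₀ k (Finset.mem_filter.mpr ⟨Finset.mem_univ _, fun k' => (hj₀top k').trans_eq heq.symm⟩)⟩
  have hLT : LT.Nonempty := ⟨j₀, hj₀LT⟩
  -- enumerate the lexicographic top set
  have hcard : LT.card = (LT.card - 1) + 1 := (Nat.succ_pred_eq_of_pos (Finset.card_pos.mpr hLT)).symm
  let e : Fin (LT.card - 1 + 1) → Fin (K + 1) := fun j' => ((LT.orderIsoOfFin hcard) j').1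
  have he : ∀ j', e j' ∈ LT := fun j' => ((LT.orderIsoOfFin hcard) j').2
  -- members of `LT` are pin-tops, share the `pinOff`-value and the `v`-value, hence are pairwise Ω-twins
  have htop : ∀ j ∈ LT, ∀ k, pinOff ι ⬝ᵥ q k ≤ pinOff ι ⬝ᵥ q j := fun j hj k => by
    rcases (Finset.mem_filter.mp hj).2 k with h1 | ⟨h1, _⟩
    · exact h1.le
    · exact h1.le
  have hveq : ∀ j ∈ LT, ∀ j' ∈ LT, v ⬝ᵥ q j = v ⬝ᵥ q j' := by
    intro j hj j' hj'
    have hw : pinOff ι ⬝ᵥ q j = pinOff ι ⬝ᵥ q j' := le_antisymm (htop j' hj' j) (htop j hj j')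
    have h1 : v ⬝ᵥ q j ≤ v ⬝ᵥ q j' := by
      rcases (Finset.mem_filter.mp hj').2 j with h2 | ⟨_, h2⟩
      · exact absurd hw h2.ne
      · exact h2
    have h2 : v ⬝ᵥ q j' ≤ v ⬝ᵥ q j := by
      rcases (Finset.mem_filter.mp hj).2 j' with h3 | ⟨_, h3⟩
      · exact absurd hw.symm h3.ne
      · exact h3
    exact le_antisymm h1 h2
  have htwin : ∀ j ∈ LT, ∀ j' ∈ LT, ∀ p, Outside ι p → q j p = q j' p := by
    intro j hj j' hj' p hp
    by_contra hne
    have hmem : (j, j') ∈ Finset.univ.filter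
        (fun jj : Fin (K + 1) × Fin (K + 1) => ∃ p, Outside ι p ∧ G jj p ≠ 0) :=
      Finset.mem_filter.mpr ⟨Finset.mem_univ _, p, hp, fun h0 => hne (sub_eq_zero.mp h0)⟩
    have h1 := hvG (j, j') hmem
    rw [dotProduct_sub, hveq j hj j' hj', sub_self] at h1
    exact h1 rfl
  refine face_of_twoScale q hℓ ι (pinOff ι) v 0 0 (pinOff_corVec_le ι) (pinOff_free ι) hv e
    (fun j' k => (Finset.mem_filter.mp (he j')).2 k) (fun j hj => ?_) (fun a b => ?_)
  · -- every lexicographic top is enumerated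
    have hjLT : j ∈ LT := Finset.mem_filter.mpr ⟨Finset.mem_univ _, hj⟩
    refine ⟨(LT.orderIsoOfFin hcard).symm ⟨j, hjLT⟩, ?_⟩
    show q ((LT.orderIsoOfFin hcard) ((LT.orderIsoOfFin hcard).symm ⟨j, hjLT⟩)).1 = q j
    rw [OrderIso.apply_symm_apply]
  · -- the read top sub-family is LL-sparse at scale `ℓ`
    have h1 := hsp (e a) (e b) (htop _ (he a)) (htop _ (he b)) (htwin _ (he a) _ (he b))
    have h2 : (⇑(delRead ι) ∘ q ∘ e) a - (⇑(delRead ι) ∘ q ∘ e) b = delRead ι (q (e a) - q (e b)) := by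
      simp only [Function.comp, map_sub]
    rw [h2]
    exact (card_idxSupp_delRead_le ι _).trans h1

/-- ★★ **SPARSE-TWIN-TOP FAMILIES ARE DECIDED.** -/
theorem sparseTwinTop_decided : Decided SparseTwinTop :=
  decided_anti (fun _ _ q hq => face_sparseLL_of_sparseTwinTop q hq) (decided_face sparseLL_decided)

/-- ★★ **THE FAT-TWIN SIEVE (enemy side, clause (E-7))**: a BUDGETED family (`r ≤ T c h`, `h ≥ h₀(c)`) has, for EVERY admissible `ι`,
two Ω-twins in the `pinOff ι`-top layer — agreeing outside `ι × ι` — whose difference touches MORE THAN `log₂ log₂ ℓ` indices. -/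
theorem enemy_fatTwins (c : ℕ) : ∃ h₀ : ℕ, ∀ h ≥ h₀, ∀ (K : ℕ) (q : Fam h K) (r : ℕ),
    HasEFOfSize (corPolytopeGraph (⊤ : SimpleGraph (Fin h)) + convexHull ℝ (Set.range q)) r → r ≤ T c h →
    ∀ ℓ : ℕ, Nat.sqrt h ≤ ℓ → ∀ ι : Fin ℓ ↪ Fin h, ∃ j j',
      (∀ k, pinOff ι ⬝ᵥ q k ≤ pinOff ι ⬝ᵥ q j) ∧ (∀ k, pinOff ι ⬝ᵥ q k ≤ pinOff ι ⬝ᵥ q j') ∧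
      (∀ p, Outside ι p → q j p = q j' p) ∧ Nat.log 2 (Nat.log 2 ℓ) < (idxSupp (q j - q j')).card := by
  obtain ⟨h₀, hh₀⟩ := sparseTwinTop_decided c
  refine ⟨h₀, fun h hh K q r hEF hr ℓ hℓ ι => ?_⟩
  by_contra hne
  push Not at hne
  have hq : SparseTwinTop h K q := ⟨ℓ, hℓ, ι, fun j j' h1 h2 h3 => hne j j' h1 h2 h3⟩
  exact absurd (hh₀ h hh K q r hq hEF) (not_lt.2 hr)

/-- the twins of `enemy_fatTwins` are DISTINCT members (a nonzero difference). -/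
theorem ne_of_idxSupp_card_pos {h K : ℕ} (q : Fam h K) (j j' : Fin (K + 1)) (hpos : 0 < (idxSupp (q j - q j')).card) : q j ≠ q j' := by
  intro heq
  obtain ⟨z, hz⟩ := Finset.card_pos.mp hpos
  obtain ⟨z', hz'⟩ := (Finset.mem_filter.mp hz).2
  rw [heq, sub_self] at hz'
  rcases hz' with h1 | h1 <;> exact h1 rfl

/-- and their difference is SUPPORTED INSIDE `ι × ι` (restating the Ω-agreement). -/
theorem sub_eq_zero_outside {h K ℓ : ℕ} (q : Fam h K) (ι : Fin ℓ ↪ Fin h) (j j' : Fin (K + 1))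
    (htwin : ∀ p, Outside ι p → q j p = q j' p) (p : Fin h × Fin h) (hp : Outside ι p) : (q j - q j') p = 0 := by
  rw [Pi.sub_apply, htwin p hp, sub_self]

/-! ## §2 THE VERTEX-COUNT FLOOR (`enemy_many_members`): C(h,s) ≤ N² · C(ℓ,s), s = ⌊log₂ log₂ ℓ⌋ + 1

Double count over the `ℓ`-subsets `S ⊆ Fin h` (each read as `ι_S = S.orderEmbOfFin`): `enemy_fatTwins` hands every `S` a pair of Ω-twins
whose difference has index support of size `≥ s` INSIDE `S` (`idxSupp_subset_range`); fixing per pair one `s`-subset `W` of that support, the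
pair serves only the `S ⊇ W`, which are `≤ C(h − s, ℓ − s)` many (`card_supersets_le`); so `C(h, ℓ) ≤ N² · C(h − s, ℓ − s)`
(`choose_le_of_fatTwins`) and `Nat.choose_mul` turns this into `C(h, s) ≤ N² · C(ℓ, s)`, i.e. `N ≥ (h/ℓ)^{s/2}` — with `ℓ = ⌊√h⌋`:
`N ≥ h^{(log₂ log₂ h)/4 − o(1)}`; no polynomial-size list is an enemy. -/

/-- Ω-twins differ only inside `ι × ι`: the index support of their difference lies in `Set.range ι`. -/
theorem idxSupp_subset_range {h K ℓ : ℕ} (q : Fam h K) (ι : Fin ℓ ↪ Fin h) (j j' : Fin (K + 1))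
    (htwin : ∀ p, Outside ι p → q j p = q j' p) : ∀ z ∈ idxSupp (q j - q j'), z ∈ Set.range ι := by
  intro z hz
  by_contra hzr
  have hne : ∀ a, ι a ≠ z := fun a ha => hzr ⟨a, ha⟩
  obtain ⟨z', hz'⟩ := (Finset.mem_filter.mp hz).2
  rcases hz' with h1 | h1
  · exact h1 (sub_eq_zero_outside q ι j j' htwin (z, z') (Or.inl hne))
  · exact h1 (sub_eq_zero_outside q ι j j' htwin (z', z) (Or.inr hne))

/-- the `ℓ`-subsets of `Fin h` containing a fixed `s`-set `W` number at most `C(h − s, ℓ − s)`. -/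
theorem card_supersets_le {h ℓ s : ℕ} (W : Finset (Fin h)) (hW : W.card = s) :
    (((Finset.univ : Finset (Fin h)).powersetCard ℓ).filter (fun S => W ⊆ S)).card ≤ (h - s).choose (ℓ - s) := by
  classical
  have htarget : (((Finset.univ : Finset (Fin h)) \ W).powersetCard (ℓ - s)).card = (h - s).choose (ℓ - s) := by
    rw [Finset.card_powersetCard, Finset.card_sdiff_of_subset (Finset.subset_univ W), Finset.card_univ, Fintype.card_fin, hW]
  rw [← htarget]
  refine Finset.card_le_card_of_injOn (fun S => S \ W) (fun S hS => ?_) (fun S₁ hS₁ S₂ hS₂ heq => ?_)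
  · have hS' := Finset.mem_filter.mp (Finset.mem_coe.mp hS)
    have hcard : S.card = ℓ := (Finset.mem_powersetCard.mp hS'.1).2
    refine Finset.mem_coe.mpr (Finset.mem_powersetCard.mpr ⟨Finset.sdiff_subset_sdiff (Finset.subset_univ S) le_rfl, ?_⟩)
    rw [Finset.card_sdiff_of_subset hS'.2, hcard, hW]
  · have h1 := (Finset.mem_filter.mp (Finset.mem_coe.mp hS₁)).2
    have h2 := (Finset.mem_filter.mp (Finset.mem_coe.mp hS₂)).2
    have e1 : S₁ = S₁ \ W ∪ W := (Finset.sdiff_union_of_subset h1).symm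
    have e2 : S₂ = S₂ \ W ∪ W := (Finset.sdiff_union_of_subset h2).symm
    rw [e1, e2]
    exact congrArg (· ∪ W) heq

/-- ★ THE DOUBLE COUNT: if EVERY `ι : Fin ℓ ↪ Fin h` carries Ω-twins differing on `≥ s` indices, then `C(h, ℓ) ≤ N² · C(h − s, ℓ − s)`
(`N = K + 1` members). -/
theorem choose_le_of_fatTwins {h K ℓ s : ℕ} (q : Fam h K)
    (hfat : ∀ ι : Fin ℓ ↪ Fin h, ∃ j j', (∀ p, Outside ι p → q j p = q j' p) ∧ s ≤ (idxSupp (q j - q j')).card) :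
    h.choose ℓ ≤ (K + 1) ^ 2 * (h - s).choose (ℓ - s) := by
  classical
  -- one `s`-subset of the support per pair
  let W : Fin (K + 1) × Fin (K + 1) → Finset (Fin h) := fun p =>
    if hp : s ≤ (idxSupp (q p.1 - q p.2)).card then Classical.choose (Finset.exists_subset_card_eq hp) else ∅
  have hWsub : ∀ p, s ≤ (idxSupp (q p.1 - q p.2)).card → W p ⊆ idxSupp (q p.1 - q p.2) ∧ (W p).card = s := by
    intro p hp
    have := Classical.choose_spec (Finset.exists_subset_card_eq hp)
    simp only [W, dif_pos hp]
    exact this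
  let 𝒮 : Finset (Finset (Fin h)) := (Finset.univ : Finset (Fin h)).powersetCard ℓ
  have h𝒮 : 𝒮.card = h.choose ℓ := by
    rw [Finset.card_powersetCard, Finset.card_univ, Fintype.card_fin]
  let cell : Fin (K + 1) × Fin (K + 1) → Finset (Finset (Fin h)) := fun p => 𝒮.filter (fun S => W p ⊆ S)
  -- every `ℓ`-set lies in the cell of its fat pair
  have hcover : 𝒮 ⊆ (Finset.univ : Finset (Fin (K + 1) × Fin (K + 1))).biUnion
      (fun p => if (W p).card = s then cell p else ∅) := by
    intro S hS
    have hcard : S.card = ℓ := (Finset.mem_powersetCard.mp hS).2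
    let ι : Fin ℓ ↪ Fin h := (S.orderEmbOfFin hcard).toEmbedding
    have hrange : ∀ z, z ∈ Set.range ι → z ∈ S := by
      rintro z ⟨a, rfl⟩
      exact Finset.orderEmbOfFin_mem S hcard a
    obtain ⟨j, j', htwin, hs⟩ := hfat ι
    obtain ⟨hW1, hW2⟩ := hWsub (j, j') hs
    refine Finset.mem_biUnion.mpr ⟨(j, j'), Finset.mem_univ _, ?_⟩
    rw [if_pos hW2]
    refine Finset.mem_filter.mpr ⟨hS, fun z hz => ?_⟩
    exact hrange z (idxSupp_subset_range q ι j j' htwin z (hW1 hz))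
  calc h.choose ℓ = 𝒮.card := h𝒮.symm
    _ ≤ _ := Finset.card_le_card hcover
    _ ≤ ∑ p, (if (W p).card = s then cell p else ∅).card := Finset.card_biUnion_le
    _ ≤ ∑ _p : Fin (K + 1) × Fin (K + 1), (h - s).choose (ℓ - s) := by
        refine Finset.sum_le_sum fun p _ => ?_
        by_cases hp : (W p).card = s
        · rw [if_pos hp]
          exact card_supersets_le (W p) hp
        · rw [if_neg hp, Finset.card_empty]
          exact Nat.zero_le _
    _ = (K + 1) ^ 2 * (h - s).choose (ℓ - s) := by
        rw [Finset.sum_const, Finset.card_univ, Fintype.card_prod, Fintype.card_fin, smul_eq_mul, sq]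

/-- `C(h,ℓ) ≤ N²·C(h−s,ℓ−s)` ⟹ `C(h,s) ≤ N²·C(ℓ,s)` (for `s ≤ ℓ ≤ h`, by `Nat.choose_mul`). -/
theorem choose_le_of_choose_le {h ℓ s N2 : ℕ} (hsl : s ≤ ℓ) (hlh : ℓ ≤ h)
    (hc : h.choose ℓ ≤ N2 * (h - s).choose (ℓ - s)) : h.choose s ≤ N2 * ℓ.choose s := by
  have hpos : 0 < (h - s).choose (ℓ - s) := Nat.choose_pos (Nat.sub_le_sub_right hlh s)
  have hmul : h.choose ℓ * ℓ.choose s = h.choose s * (h - s).choose (ℓ - s) := Nat.choose_mul (n := h) hsl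
  refine Nat.le_of_mul_le_mul_right ?_ hpos
  calc h.choose s * (h - s).choose (ℓ - s) = h.choose ℓ * ℓ.choose s := hmul.symm
    _ ≤ N2 * (h - s).choose (ℓ - s) * ℓ.choose s := Nat.mul_le_mul_right _ hc
    _ = N2 * ℓ.choose s * (h - s).choose (ℓ - s) := by ring

/-- ★★ **THE VERTEX-COUNT FLOOR (enemy side)**: a budgeted family with `N = K + 1` members satisfies, for every admissible read size
`⌊√h⌋ ≤ ℓ ≤ h` and `s = ⌊log₂ log₂ ℓ⌋ + 1`:  `C(h, s) ≤ N² · C(ℓ, s)` — so `N ≥ (h/ℓ)^{s/2}`. -/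
theorem enemy_many_members (c : ℕ) : ∃ h₀ : ℕ, ∀ h ≥ h₀, ∀ (K : ℕ) (q : Fam h K) (r : ℕ),
    HasEFOfSize (corPolytopeGraph (⊤ : SimpleGraph (Fin h)) + convexHull ℝ (Set.range q)) r → r ≤ T c h →
    ∀ ℓ : ℕ, Nat.sqrt h ≤ ℓ → ℓ ≤ h →
      h.choose (Nat.log 2 (Nat.log 2 ℓ) + 1) ≤ (K + 1) ^ 2 * ℓ.choose (Nat.log 2 (Nat.log 2 ℓ) + 1) := by
  obtain ⟨h₀, hh₀⟩ := enemy_fatTwins c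
  refine ⟨h₀, fun h hh K q r hEF hr ℓ hℓ hℓh => ?_⟩
  set s := Nat.log 2 (Nat.log 2 ℓ) + 1 with hs
  rcases Nat.eq_zero_or_pos ℓ with hℓ0 | hℓpos
  · -- `ℓ = 0` forces `h = 0`, and `C(0, s) = 0` for `s ≥ 1`
    have hh0 : h = 0 := Nat.sqrt_eq_zero.mp (Nat.le_zero.mp (hℓ0 ▸ hℓ))
    subst hh0
    rw [Nat.choose_eq_zero_of_lt (by omega)]
    exact Nat.zero_le _
  · have hsl : s ≤ ℓ := by
      have h1 : Nat.log 2 (Nat.log 2 ℓ) ≤ Nat.log 2 ℓ := Nat.log_le_self 2 _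
      have h2 : Nat.log 2 ℓ < ℓ := Nat.log_lt_self 2 hℓpos.ne'
      omega
    have hfat : ∀ ι : Fin ℓ ↪ Fin h, ∃ j j', (∀ p, Outside ι p → q j p = q j' p) ∧ s ≤ (idxSupp (q j - q j')).card := by
      intro ι
      obtain ⟨j, j', -, -, htwin, hlt⟩ := hh₀ h hh K q r hEF hr ℓ hℓ ι
      exact ⟨j, j', htwin, hlt⟩
    exact choose_le_of_choose_le hsl hℓh (choose_le_of_fatTwins q hfat)

/-- the floor at the canonical read size `ℓ = ⌊√h⌋`: `C(h, s) ≤ N² · C(⌊√h⌋, s)`, `s = ⌊log₂ log₂ ⌊√h⌋⌋ + 1`. -/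
theorem enemy_many_members_sqrt (c : ℕ) : ∃ h₀ : ℕ, ∀ h ≥ h₀, ∀ (K : ℕ) (q : Fam h K) (r : ℕ),
    HasEFOfSize (corPolytopeGraph (⊤ : SimpleGraph (Fin h)) + convexHull ℝ (Set.range q)) r → r ≤ T c h →
      h.choose (Nat.log 2 (Nat.log 2 (Nat.sqrt h)) + 1) ≤
        (K + 1) ^ 2 * (Nat.sqrt h).choose (Nat.log 2 (Nat.log 2 (Nat.sqrt h)) + 1) := by
  obtain ⟨h₀, hh₀⟩ := enemy_many_members c
  exact ⟨h₀, fun h hh K q r hEF hr => hh₀ h hh K q r hEF hr (Nat.sqrt h) le_rfl (Nat.sqrt_le_self h)⟩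

end Summit.ValiantsHypothesis.ValiantsHypothesis.Cruxes.NNDivisionHard.FatTwins44

end
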